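import Summits.CriticalPhenomena.PercolationContinuityZ3.Theorems.FK.Transplant.FreeBoundaryHypotheses
import Summits.CriticalPhenomena.PercolationContinuityZ3.Theorems.FK.ContinuityQOneRegression
import HarnessLib

/-!
# The crux layer of the FK-continuity lift, typed (FO-05): `FKRobustLawful` (C1), the FK continuation
principle (C2), the same-`p` free-boundary criterion (C3a), the run (C3b), and `¬UFSC0` at `p_c(q)`

builds on p205010 (kernel theorem, internal audit signed; external expert review pending).
Cell `fk-continuity`, row FO-05 (SCOPING.md §3.6 "Typed crux shapes", FANOUT-PLAN.md FO-05). FO-19 = NO-GO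
(2026-08-21): these are PROGRAMME STATEMENTS (`def … : Prop`), typed so that FO-11 (C2), FT-07 (C3b), FO-12/FO-13
(audits) and the conditional transplant (K1) can be stated against fixed declarations; nothing here is asserted,
no route files them (`no_new_routes`), and C3a in particular is NOT claimed — for `q ∈ (1,2)` it contains
Grimmett's Conj. (5.103)-type content (barrier note `Literature.Barriers.CriticalPhenomena.SamePFreeBoundaryCriteria`,
decl `samePFreeBoundaryCriteria`).

## Design (why these shapes)
* The vocabulary of the finite-size side is IMPORTED BY NAME from `Transplant/FreeBoundaryHypotheses.lean`
  (p243857): `fkLaw`, `condFK`, `badFK`, `ValidFK`, `OriginFK`, `UFSC0` — never re-typed here (cell ruling R16).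
* C1 `FKRobustLawful d q p ε N E` is the FK twin of tree `HSiteScheme.Lawful` (LP/HistorySiteRenormalization.lean)
  in the ONLY form that is continuable in `p` (refuter F4, lead ruling L5): after every history at which the
  scheme probes, the probe's failure is covered by boundedly many DECREASING "bad" events, one per onward
  direction, each living on a FINITE region and each bounded under the MINIMAL law of its region — the
  random-cluster law `fkLaw` on the region with the revealed pattern pinned, the initial edges wired open and
  FREE boundary conditions outside (weighting `restrW R (pinW (lattW d p) F(h) ξ(h))`, i.e. KN's `Wfull` with the
  lattice parameter DECOUPLED from the scheme's internal design parameter, so that `lawful_of_near`-type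
  continuation can move `p` while the scheme stays fixed). The sum of the minimal-law bounds is `≤ ε`.
  Decreasing + local is exactly what the domain-Markov/comparison step of C2 consumes (true conditional law given
  the history DOMINATES the minimal law for `q ≥ 1`, Grimmett 2006 Lemma (4.13)/(3.22)); the fresh-edge bound `N`
  is what the `q·N`-Lipschitz continuity in `p` consumes (FO-09 `EdgeDensityCovariance`). No constant is an
  ambient-`φ⁰` threshold (T1⁺); no "which cluster" identification occurs (S1-free).
* `FKScheme d` is the interface positing the per-direction structure (regions, bad events, onward directions) on
  top of a tree `HSiteScheme (Site d)`; its CONSTRUCTION from a `UFSC0` witness is the statement C3b (interface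
  and existence kept apart). For Kozma–Nitzan's scheme: `dirs h e = S.onward h (tgt e)`, `reg = S.Sx`,
  `bad = badFK S q`, and `minW` is `S.Wfull` with `p` for `S.p` (definitionally, since `S.F h = S.U₀ ∪ supp h`,
  `S.ξ h = S.U₀ ∪ opens h`).
* C2 concludes `p_c(q) < p`; soundness of the renormalisation (an infinite macro-cluster forces `0 ↔ ∞`) and
  `U₀ ⊆ E(ℤ^d)` are separate hypotheses exactly as in tree `SameP.criticalProb_lt_of_lawful` (q = 1).
* C3a is typed in the ALL-`p` form (SCOPING §3.3 [g4]): hypothesis `0 < thetaFree d p q` for arbitrary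
  `p ∈ (0,1)`, never specialised to `p = p_c(q)` (at `p_c(q)`, `q > Q(3)`, the hypothesis is false and the
  statement vacuous — `RandomClusterFirstOrderNarrow`).
* Certified seams (sorry-free, a few lines each): C2 ∧ C3b ⇒ `¬UFSC0` at `p_c(q)`; C2 ∧ C3a ∧ C3b ⇒
  `FKContinuityFree d q` (given `p_c(q) < 1`); hence ⇒ `FKFreeCriticalZ3` ⇒ the summit conjunct via the landed
  q = 1 regression `percolationContinuityZ3_of_freeAllQ` — the composition check that the typed Props reach the
  target, exactly as `SameP.theta_criticalProb_eq_zero_of_drop` does at `q = 1`.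

References: Kozma–Nitzan 2024 §4 pp. 25–31 ((28)–(33)); Grimmett 2006 §4.3 Lemma (4.13), Thm (3.21)/(3.22),
§5.1 (5.1)–(5.5), Conj. (5.103), Conj. (6.32)(a).
-/

noncomputable section

open MeasureTheory
open scoped ENNReal Classical

namespace Summit.CriticalPhenomena.PercolationContinuityZ3.Theorems.FK

open Literature.Probability.Percolation Literature.Probability.LatticeModels SimpleGraph
open Literature.Probability.Percolation.GadgetSystem Literature.Probability.Percolation.KozmaNitzan
open Literature.Barriers.CriticalPhenomena

variable {d : ℕ}

/-! ## C1 — FK-robust lawfulness of a history-driven site scheme -/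

/-- **An FK history scheme on `ℤ^d`**: a history-driven site-renormalisation scheme (tree `HSiteScheme`:
adaptive explorer, initial edges `U₀`, success criterion) together with, for every history `h` and chosen
macro-edge `e`, the finite set of ONWARD DIRECTIONS examined, and per direction a finite REGION of `ℤ^d` and a
BAD EVENT (Kozma–Nitzan: `X = X_v`, `E_i ∪ E_{w,v} ∪ E_{v,x}`, "the connection `v–x` is good at no level").
Data only; its axioms are `FKRobustLawful`. [cite: KozmaNitzan2024, §4 pp. 26–27 ((29)–(31))] -/
structure FKScheme (d : ℕ) extends HSiteScheme (Site d) where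
  /-- the onward directions examined after history `h` along the macro-edge `e` -/
  dirs : ProbeHistory (Site d) → Site 2 × MDir → Finset MDir
  /-- the finite region carrying the minimal law of direction `du` -/
  reg : ProbeHistory (Site d) → Site 2 × MDir → MDir → Finset (Site d)
  /-- the bad event of direction `du` -/
  bad : ProbeHistory (Site d) → Site 2 × MDir → MDir → Set (BondConfig (Site d))

namespace FKScheme

/-- The revealed edges after a history: the initial edges and everything examined (KN's `F(h)`; for a
Kozma–Nitzan scheme this is `KSch.F`). [cite: KozmaNitzan2024, §4 p. 26 (ω|_{E_i})] -/
def revealed (E : FKScheme d) (h : ProbeHistory (Site d)) : Finset (Sym2 (Site d)) := E.U₀ ∪ ProbeHistory.supp h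

/-- The recorded open pattern after a history: the initial edges (all open on `A₀`) and the examined edges
found open (KN's `ξ(h)`; tree `KSch.ξ`). [cite: KozmaNitzan2024, §4 p. 26 (ω|_{E_i})] -/
def pattern (E : FKScheme d) (h : ProbeHistory (Site d)) : Finset (Sym2 (Site d)) := E.U₀ ∪ opens h

/-- **The minimal-law weighting** of the region `R` after history `h` at lattice parameter `p`: lattice edges
weight `p`, the revealed edges pinned to the recorded pattern, every pair off `R` weight `0` (free boundary
conditions outside `R`). Tree `KSch.Wfull` with the law parameter decoupled from the scheme.
[cite: KozmaNitzan2024, §4 p. 28 (Ω, P_{R_x,h})] -/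
def minW (E : FKScheme d) (p : unitInterval) (h : ProbeHistory (Site d)) (R : Finset (Site d)) :
    Sym2 (Site d) → unitInterval :=
  restrW (↑R : Set (Site d)) (pinW (lattW d p) ↑(E.revealed h) ↑(E.pattern h))

/-- For a Kozma–Nitzan scheme `S` and any FK history scheme with the same initial edges, the minimal-law
weighting at the scheme's own parameter on KN's region `E_i ∪ E_{w,v} ∪ E_{v,x}` IS KN's `Wfull`
(definitionally) — so `UFSC0`'s per-direction failure clause is literally the `fail` clause of
`FKRobustLawful` below for the KN instance (C3b). [cite: KozmaNitzan2024, §4 p. 28 (Ω, P_{R_x,h})] -/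
theorem minW_eq_Wfull (E : FKScheme d) (S : KSch d) (hU : E.U₀ = S.U₀) (h : ProbeHistory (Site d))
    (e : Site 2 × MDir) (du : MDir) : E.minW S.p h (S.Sx h e du) = S.Wfull h e du := by
  unfold minW revealed pattern KSch.Wfull KSch.F KSch.ξ
  rw [hU]

/-- The fresh lattice edges of the region `R` after history `h` (those carrying the parameter `p` in `minW`).
[cite: KozmaNitzan2024, §4 p. 28] -/
def fresh (E : FKScheme d) (h : ProbeHistory (Site d)) (R : Finset (Site d)) : Finset (Sym2 (Site d)) :=
  edgesIn (zdGraph d) R \ E.revealed h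

/-- Off the pairs inside `R` the minimal-law weight is `0`. [folklore] -/
theorem minW_apply_of_not_mem_wireSet (E : FKScheme d) (p : unitInterval) (h : ProbeHistory (Site d))
    (R : Finset (Site d)) {e : Sym2 (Site d)} (he : e ∉ wireSet (↑R : Set (Site d))) :
    E.minW p h R e = 0 := by
  unfold minW; exact restrW_apply_of_not_mem _ he

/-- A revealed pair inside `R` lying on the pinned-open pattern (`U₀ ∪ opens h`) has weight `1`. [folklore] -/
theorem minW_apply_of_mem_pattern (E : FKScheme d) (p : unitInterval) (h : ProbeHistory (Site d))
    (R : Finset (Site d)) {e : Sym2 (Site d)} (he : e ∈ wireSet (↑R : Set (Site d)))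
    (hr : e ∈ E.revealed h) (hx : e ∈ E.pattern h) : E.minW p h R e = 1 := by
  unfold minW; rw [restrW_apply_of_mem _ he]
  exact pinW_apply_of_mem_of_mem _ (Finset.mem_coe.2 hr) (Finset.mem_coe.2 hx)

/-- A revealed pair inside `R` off the pattern (revealed closed) has weight `0`. [folklore] -/
theorem minW_apply_of_not_mem_pattern (E : FKScheme d) (p : unitInterval) (h : ProbeHistory (Site d))
    (R : Finset (Site d)) {e : Sym2 (Site d)} (he : e ∈ wireSet (↑R : Set (Site d)))
    (hr : e ∈ E.revealed h) (hx : e ∉ E.pattern h) : E.minW p h R e = 0 := by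
  unfold minW; rw [restrW_apply_of_mem _ he]
  exact pinW_apply_of_mem_of_not_mem _ (Finset.mem_coe.2 hr) (mt Finset.mem_coe.1 hx)

/-- An unrevealed pair inside `R` carries the lattice weight (`p` on lattice edges, `0` on other pairs). [folklore] -/
theorem minW_apply_of_not_mem_revealed (E : FKScheme d) (p : unitInterval) (h : ProbeHistory (Site d))
    (R : Finset (Site d)) {e : Sym2 (Site d)} (he : e ∈ wireSet (↑R : Set (Site d)))
    (hr : e ∉ E.revealed h) : E.minW p h R e = lattW d p e := by
  unfold minW; rw [restrW_apply_of_mem _ he]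
  exact pinW_apply_of_not_mem _ _ (mt Finset.mem_coe.1 hr)

/-- On a fresh lattice edge of `R` the minimal-law weight is the parameter `p`. [folklore] -/
theorem minW_apply_of_mem_fresh (E : FKScheme d) (p : unitInterval) (h : ProbeHistory (Site d))
    (R : Finset (Site d)) {e : Sym2 (Site d)} (he : e ∈ E.fresh h R) : E.minW p h R e = p := by
  unfold FKScheme.fresh at he
  rw [Finset.mem_sdiff, mem_edgesIn_iff] at he
  obtain ⟨⟨hG, hR⟩, hr⟩ := he
  have hw : e ∈ wireSet (↑R : Set (Site d)) :=
    ⟨fun x hx => Finset.mem_coe.2 (hR x hx), SimpleGraph.not_isDiag_of_mem_edgeSet _ hG⟩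
  rw [E.minW_apply_of_not_mem_revealed p h R hw hr, lattW_apply, if_pos hG]

/-- **The minimal-law weights at two parameters differ only on the fresh lattice edges of `R`** (at most
`N` of them under `FKRobustLawful … N E`) — the input of the Lipschitz-in-`p` estimate of C2. [folklore] -/
theorem minW_congr_of_not_mem_fresh (E : FKScheme d) (p p' : unitInterval) (h : ProbeHistory (Site d))
    (R : Finset (Site d)) {e : Sym2 (Site d)} (he : e ∉ E.fresh h R) :
    E.minW p h R e = E.minW p' h R e := by
  by_cases hw : e ∈ wireSet (↑R : Set (Site d))
  · by_cases hr : e ∈ E.revealed h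
    · unfold minW
      rw [restrW_apply_of_mem _ hw, restrW_apply_of_mem _ hw, pinW_apply, pinW_apply,
        if_pos (Finset.mem_coe.2 hr), if_pos (Finset.mem_coe.2 hr)]
    · have hG : e ∉ (zdGraph d).edgeSet := by
        intro hG
        apply he
        unfold FKScheme.fresh
        rw [Finset.mem_sdiff, mem_edgesIn_iff]
        exact ⟨⟨hG, fun x hx => Finset.mem_coe.1 (hw.1 x hx)⟩, hr⟩
      rw [E.minW_apply_of_not_mem_revealed p h R hw hr, E.minW_apply_of_not_mem_revealed p' h R hw hr,
        lattW_apply, lattW_apply, if_neg hG, if_neg hG]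
  · rw [E.minW_apply_of_not_mem_wireSet p h R hw, E.minW_apply_of_not_mem_wireSet p' h R hw]

/-- **The per-direction minimal law** `E.law q p h e du`: the random-cluster measure with cluster weight `q` on
the region `E.reg h e du` under the minimal-law weighting at lattice parameter `p` (revealed pattern pinned,
`U₀` open, free outside the region), as a law on bond configurations of `ℤ^d` (tree `fkLaw`). C1's `fail`, the
pinned domination and the Lipschitz estimate of C2 are all stated against it.
[cite: KozmaNitzan2024, §4 p. 28 (Ω, P_{R_x,h})] [cite: Grimmett2006, (4.2), Lemma (4.13)] -/
def law (E : FKScheme d) (q : ℝ) (p : unitInterval) (h : ProbeHistory (Site d)) (e : Site 2 × MDir)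
    (du : MDir) : Measure (BondConfig (Site d)) :=
  fkLaw (E.reg h e du) (E.minW p h (E.reg h e du)) q

/-- For an FK history scheme with KN's initial edges and KN's regions, the per-direction minimal law at the
scheme's own parameter is `fkLaw (Sx) (Wfull) q` — the law in `UFSC0`'s failure clause (C3b). [folklore] -/
theorem law_eq_fkLaw_Wfull (E : FKScheme d) (S : KSch d) (hU : E.U₀ = S.U₀) (hreg : E.reg = S.Sx) (q : ℝ)
    (h : ProbeHistory (Site d)) (e : Site 2 × MDir) (du : MDir) :
    E.law q S.p h e du = fkLaw (S.Sx h e du) (S.Wfull h e du) q := by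
  rw [law, hreg, minW_eq_Wfull E S hU]

/-- **Soundness of the renormalisation**: the initial edges are lattice edges, and (for configurations of
lattice edges) an infinite final macro-cluster on `A₀` forces an infinite open cluster at the origin — the
hypotheses `hU`, `hperc` of tree `SameP.criticalProb_lt_of_lawful`, bundled. [cite: KozmaNitzan2024, §4 pp. 26–27 ((2)–(3))] -/
def Sound (E : FKScheme d) : Prop :=
  (↑E.U₀ : Set (Sym2 (Site d))) ⊆ (zdGraph d).edgeSet ∧
    E.toHSiteScheme.initEvent ∩ {ω | (E.toHSiteScheme.occFinal ω).Infinite} ⊆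
      percolatesAt (0 : Site d) ∪ {ω | ¬ω ⊆ (zdGraph d).edgeSet}

end FKScheme

/-- **C1 — `FKRobustLawful d q p ε N E`: the scheme `E` is robustly lawful for FK(`q`) at lattice parameter `p`.**
Freshness and probing as in tree `HSiteScheme.Lawful`; and after every history `h` at which a probe `P` is made
along the chosen macro-edge `e`: the failure of the probe is covered by the bad events of the onward directions;
each bad event is DECREASING and determined by the lattice edges of its region; each region has at most `N`
fresh lattice edges; and the bad events have total probability at most `ε` under the MINIMAL random-cluster
laws of their regions (`E.law` = `fkLaw` of `minW`: revealed pattern pinned, `U₀` open, free outside the region).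
Per-direction minimal-law form = the only form that transfers to the conditional law of the run for `q ≥ 1`
(decreasing events, Grimmett 2006 (3.22)/(4.13)) and is Lipschitz in `p` uniformly (`≤ q·N`).
[cite: KozmaNitzan2024, §4 p. 25 (Definition, (4) = (28)), pp. 28–31 ((32)–(33))] [cite: Grimmett2006, Lemma (4.13), Thm. (3.21)] -/
structure FKRobustLawful (d : ℕ) (q : ℝ) (p : unitInterval) (ε : ℝ) (N : ℕ) (E : FKScheme d) : Prop where
  fresh : E.E.Fresh (↑E.U₀ : Set (Sym2 (Site d)))
  probes : ∀ ω : BondConfig (Site d), ω ⊆ (zdGraph d).edgeSet →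
    ∀ n, (E.toHSiteScheme.stN n ω).choice ≠ none → E.E.next (E.E.hist n ω) ≠ none
  cover : ∀ h P e, E.E.next h = some P → (E.toHSiteScheme.mst h).choice = some e →
    {ω | ¬E.succ h e (P.read ω)} ⊆ ⋃ du ∈ E.dirs h e, E.bad h e du
  lower : ∀ h e du, IsLowerSet (E.bad h e du)
  determined : ∀ h e du, DeterminedBy (E.bad h e du) (↑(edgesIn (zdGraph d) (E.reg h e du)) : Set (Sym2 (Site d)))
  freshCard : ∀ h P e, E.E.next h = some P → (E.toHSiteScheme.mst h).choice = some e →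
    ∀ du ∈ E.dirs h e, (E.fresh h (E.reg h e du)).card ≤ N
  fail : ∀ h P e, E.E.next h = some P → (E.toHSiteScheme.mst h).choice = some e →
    ∑ du ∈ E.dirs h e, (E.law q p h e du).real (E.bad h e du) ≤ ε

/-! ## C2 — the FK continuation principle -/

/-- **C2 — the FK(`q`) continuation principle on `ℤ^d`**: a sound FK history scheme robustly lawful at
`(p, ε)` with `ε < 2⁻³²` and `0 < p < 1` forces `p_c(q) < p`. Port of tree `SameP.criticalProb_lt_of_lawful`
(q = 1): continuity of the minimal laws in `p` (uniform, `≤ q·N`, Grimmett 2006 Thm (2.43)–(2.46)) makes the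
same scheme robustly lawful at some `p' < p` with `ε' ≤ 2⁻³²`; domain Markov + comparison of boundary
conditions (Lemma (4.13)) bound the run's conditional failure probabilities under `φ^b_{p',q}` by the minimal
laws; the Peierls driver of tree `HSiteScheme.measureReal_le_three_mul_of_subset` gives `θ(p',q) > 0`.
Expected PROVABLE for every `d ≥ 2`, `q ≥ 1` (row FO-11); a programme statement here.
[cite: KozmaNitzan2024, §1 p. 2 (approach 1), §4 p. 25] [cite: Grimmett2006, Thm. (2.43), Lemma (4.13), §5.1 (5.2)] -/
@[conjecture] def FKContinuationPrinciple (d : ℕ) (q : ℝ) : Prop :=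
  ∀ (p : unitInterval) (ε : ℝ) (N : ℕ) (E : FKScheme d),
    FKRobustLawful d q p ε N E → ε < (1 / 2 : ℝ) ^ 32 → 0 < (p : ℝ) → (p : ℝ) < 1 → E.Sound →
      rcCriticalProb d q < p

/-! ## C3 — the same-`p` criterion (C3a) and the run (C3b) -/

/-- **C3a — the same-`p` free-boundary finite-size criterion from free percolation** (ALL-`p` form): for
every `p ∈ (0,1)` at which the FREE random-cluster model percolates, the uniform finite-size criterion
`UFSC0 d q p r ε₀` holds at some scale `r`. For `q = 1` this is Kozma–Nitzan §4 (tree `KSch.lawful`'s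
hypotheses from `θ(p) > 0`); for `q > 1` it is OPEN and contains Conj. (5.103)-type content (barrier note
`SamePFreeBoundaryCriteria`; FO-19 NO-GO): a programme statement, NOT claimed. Stated for arbitrary `p`, never at
`p = p_c(q)` only (there it is vacuous for `q > Q(d)`). [cite: Grimmett2006, Conj. (5.103), Lemma (5.102)] [cite: KozmaNitzan2024, §4 Theorem 6] -/
@[conjecture] def FKCriterionOfThetaFree (d : ℕ) (q : ℝ) (ε₀ : ℝ) : Prop :=
  ∀ p : unitInterval, 0 < (p : ℝ) → (p : ℝ) < 1 → 0 < thetaFree d p q → ∃ r : ℕ, UFSC0 d q p r ε₀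

/-- **C3b — the run**: a `UFSC0 d q p r ε₀` witness yields a SOUND FK history scheme robustly lawful at
`(p, 4ε₀)` with bounded fresh regions — Kozma–Nitzan's Theorem 6 run under free boundary conditions: every run
history with a candidate is FK-valid ((32) transported along the run by region/history monotonicity for
`q ≥ 1`), the failed examination has a bad onward direction (`≤ 4` of them), the bad events are decreasing and
local, and an infinite macro-cluster forces `0 ↔ ∞`. Expected PROVABLE for `q ≥ 1` (row FT-07); a programme
statement here. [cite: KozmaNitzan2024, §4 Theorem 6, pp. 25–31] [cite: Grimmett2006, Thm. (3.21)] -/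
@[conjecture] def FKLawfulOfCriterion (d : ℕ) (q : ℝ) : Prop :=
  ∀ (p : unitInterval) (r : ℕ) (ε₀ : ℝ), UFSC0 d q p r ε₀ →
    ∃ (N : ℕ) (E : FKScheme d), FKRobustLawful d q p (4 * ε₀) N E ∧ E.Sound

/-- **`¬UFSC0` at criticality** (barrier sanity; SCOPING §3.6): at `p = p_c(q)` the uniform finite-size
criterion fails at every scale — consistent with `RandomClusterFirstOrderNarrow` (for `q > Q(3)` free boxes
ARE subcritical at `p_c(q)`). A consequence of C2 ∧ C3b (`noUFSC0AtCritical_of`). [cite: Grimmett2006, Thm. (7.33)(b), Conj. (5.103)] -/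
@[conjecture] def NoUFSC0AtCritical (d : ℕ) (q : ℝ) (ε₀ : ℝ) : Prop :=
  ∀ r : ℕ, ¬UFSC0 d q ⟨rcCriticalProb d q, rcCriticalProb_mem_Icc d q⟩ r ε₀

/-! ## Programme forms on `ℤ³` (every `q ≥ 1`; the `1 ≤ q` binder is mandatory, cell ruling R-g8-2) -/

/-- C2 on `ℤ³` for every `q ≥ 1` (row FO-11's target). [cite: KozmaNitzan2024, §1 p. 2] -/
@[conjecture] def FKContinuationZ3 : Prop := ∀ q : ℝ, 1 ≤ q → FKContinuationPrinciple 3 q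

/-- C3a on `ℤ³` for every `q ≥ 1` at precision `ε₀` (OPEN for `q > 1`; its `q = 1` instance is the content of
tree `KSch.lawful`'s hypotheses). [cite: Grimmett2006, Conj. (5.103)] -/
@[conjecture] def FKCriterionOfThetaFreeZ3 (ε₀ : ℝ) : Prop := ∀ q : ℝ, 1 ≤ q → FKCriterionOfThetaFree 3 q ε₀

/-- C3b on `ℤ³` for every `q ≥ 1` (row FT-07's target). [cite: KozmaNitzan2024, §4 Theorem 6] -/
@[conjecture] def FKLawfulOfCriterionZ3 : Prop := ∀ q : ℝ, 1 ≤ q → FKLawfulOfCriterion 3 q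

/-! ## Certified seams: the typed cruxes compose to the targets -/

section Seams

variable {q ε₀ : ℝ}

/-- C2 ∧ C3b: a `UFSC0` witness at `(p, ε₀)` with `4ε₀ < 2⁻³²`, `0 < p < 1`, forces `p_c(q) < p`.
[cite: KozmaNitzan2024, §1 p. 2 (approach 1)] -/
theorem rcCriticalProb_lt_of_ufsc0 (h2 : FKContinuationPrinciple d q) (h3b : FKLawfulOfCriterion d q)
    (hε₀ : 4 * ε₀ < (1 / 2 : ℝ) ^ 32) {p : unitInterval} (hp0 : 0 < (p : ℝ)) (hp1 : (p : ℝ) < 1) {r : ℕ}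
    (hU : UFSC0 d q p r ε₀) : rcCriticalProb d q < p := by
  obtain ⟨N, E, hL, hS⟩ := h3b p r ε₀ hU
  exact h2 p (4 * ε₀) N E hL hε₀ hp0 hp1 hS

/-- C2 ∧ C3b ⇒ `¬UFSC0` at `p_c(q)` (given `0 < p_c(q) < 1`, Grimmett 2006 Thm (5.5), `d ≥ 2`).
[cite: Grimmett2006, Thm. (5.5), Conj. (5.103)] -/
theorem noUFSC0AtCritical_of (h2 : FKContinuationPrinciple d q) (h3b : FKLawfulOfCriterion d q)
    (hε₀ : 4 * ε₀ < (1 / 2 : ℝ) ^ 32) (hpc0 : 0 < rcCriticalProb d q) (hpc1 : rcCriticalProb d q < 1) :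
    NoUFSC0AtCritical d q ε₀ :=
  fun _ hU => lt_irrefl _
    (rcCriticalProb_lt_of_ufsc0 h2 h3b hε₀ (p := ⟨_, rcCriticalProb_mem_Icc d q⟩) hpc0 hpc1 hU)

/-- **The composition**: C2 ∧ C3a ∧ C3b (with `4ε₀ < 2⁻³²`) give the free target `θ⁰(p_c(q), q) = 0` for
`q ≥ 1`, provided `p_c(q) < 1` (Grimmett 2006 Thm (5.5), `d ≥ 2`) — by contradiction at `p = p_c(q)`, exactly
as tree `SameP.theta_criticalProb_eq_zero_of_drop`. [cite: KozmaNitzan2024, §1 p. 2 (approach 1)] [cite: Grimmett2006, Conj. (6.32)(a)] -/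
theorem fkContinuityFree_of_cruxes (hq : 1 ≤ q) (hpc1 : rcCriticalProb d q < 1)
    (hε₀ : 4 * ε₀ < (1 / 2 : ℝ) ^ 32) (h2 : FKContinuationPrinciple d q)
    (h3a : FKCriterionOfThetaFree d q ε₀) (h3b : FKLawfulOfCriterion d q) : FKContinuityFree d q := by
  by_contra hne
  have hpos : 0 < thetaFree d (rcCriticalProb d q) q :=
    lt_of_le_of_ne (thetaFree_nonneg _ _) (Ne.symm hne)
  have hpc0 : 0 < rcCriticalProb d q := by
    rcases (rcCriticalProb_mem_Icc d q).1.eq_or_lt with h0 | h0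
    · exfalso
      rw [← h0, thetaFree_zero_left' d hq] at hpos
      exact lt_irrefl _ hpos
    · exact h0
  obtain ⟨r, hU⟩ := h3a ⟨_, rcCriticalProb_mem_Icc d q⟩ hpc0 hpc1 hpos
  exact lt_irrefl _
    (rcCriticalProb_lt_of_ufsc0 h2 h3b hε₀ (p := ⟨_, rcCriticalProb_mem_Icc d q⟩) hpc0 hpc1 hU)

/-- The programme composition on `ℤ³`: the three `ℤ³` forms (some `ε₀` with `4ε₀ < 2⁻³²`) and `p_c(q) < 1`
for `q ≥ 1` give Conj. (6.32)(a) on `ℤ³`, `FKFreeCriticalZ3`. [cite: Grimmett2006, Conj. (6.32)(a)] -/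
theorem fkFreeCriticalZ3_of_cruxes (hpc1 : ∀ q : ℝ, 1 ≤ q → rcCriticalProb 3 q < 1)
    (hε₀ : 4 * ε₀ < (1 / 2 : ℝ) ^ 32) (h2 : FKContinuationZ3) (h3a : FKCriterionOfThetaFreeZ3 ε₀)
    (h3b : FKLawfulOfCriterionZ3) : FKFreeCriticalZ3 :=
  fun q hq => fkContinuityFree_of_cruxes hq (hpc1 q hq) hε₀ (h2 q hq) (h3a q hq) (h3b q hq)

/-- … and hence the summit conjunct, through the landed `q = 1` regression
`percolationContinuityZ3_of_freeAllQ` (the composition reaches the Statement; nothing is claimed — C3a is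
open for `q > 1` and its `q = 1` instance is p205010's content). [cite: KozmaNitzan2024, Theorem 1] -/
theorem percolationContinuityZ3_of_cruxes (hpc1 : ∀ q : ℝ, 1 ≤ q → rcCriticalProb 3 q < 1)
    (hε₀ : 4 * ε₀ < (1 / 2 : ℝ) ^ 32) (h2 : FKContinuationZ3) (h3a : FKCriterionOfThetaFreeZ3 ε₀)
    (h3b : FKLawfulOfCriterionZ3) : _root_.PercolationContinuityZ3 :=
  percolationContinuityZ3_of_freeAllQ (fkFreeCriticalZ3_of_cruxes hpc1 hε₀ h2 h3a h3b)

end Seams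

end Summit.CriticalPhenomena.PercolationContinuityZ3.Theorems.FK

end
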